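import Summits.AnomalousDissipation.AnomalousDissipation.Theses.TaylorCertificates
import Literature.Analysis.FluidPDE.StatisticalSolutionDirac
import Literature.Analysis.FluidPDE.PassiveScalarDriftApproxStrain

/-!
# `TaylorCertificates.FloorCertificateEnsembleCeiling` (stmt-AnomalousDissipation-14086) — negative side V:
# the line `Sketch`: clause (i) of its open stub C is false without the Liouville identities

The picked line of the crux (lead `prover-line-stmt-AnomalousDissipation-14086-0`, `Cruxes/…/Lines/Sketch.lean`) has
one open stub C = `stub_dualPair`, whose clause (i) asks that, for ONE force and all small `ν`, every RELAXED
stationary statistic of `NS_ν(f)` — a probability measure on `H` carried by the Leray ball, of finite mean enstrophy,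
annihilating every cylindrical Liouville functional, with integrable work and the global energy inequality
`ε(μ) ≤ ∫(u,f)dμ` — be `ε₀`-loud. This file (cdisprove seat `refuter-cdisprove-stmt-AnomalousDissipation-14086-g2-0`,
2026-08-16) records which axiom of that class carries the clause:

* `relaxed_axioms_without_liouville_at_rest` — for EVERY force `f ∈ L²` and `ν > 0` the Dirac mass AT REST is a
  probability measure carried by the ball, of ZERO mean enstrophy (so `ε = 0`), with integrable work and the global
  energy inequality (both sides vanish);
* `stubDualPair_clause_i_false_without_liouville` — hence clause (i) of stub C with the Liouville identities deleted is
  FALSE for every force and every `ε₀ > 0` (LOAD-BEARING analysis: any proof of C(i) lives on the Liouville equation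
  FMRT IV (1.30); at rest it is indeed violated, `⟨F(0), Φ'(0)⟩ = (f, Φ'(0)) ≠ 0` for `Φ' = f` near `0`).

The other relaxed axioms have no cheap quiet violator (finitely supported Liouville-stationary measures sit on steady
states, which satisfy the energy equality) — see the crux work file `Cruxes/FloorCertificateEnsembleCeiling/Disproof.lean` §I.
-/

noncomputable section

set_option linter.dupNamespace false

open MeasureTheory UnitAddTorus Filter Topology
open scoped InnerProductSpace ENNReal

namespace Summit.AnomalousDissipation.AnomalousDissipation.Theorems.FloorCertificateEnsembleCeiling.Negative

open Literature.Analysis.FunctionSpaces Literature.Analysis.FluidPDE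
open Summit.AnomalousDissipation.AnomalousDissipation.Theses.TaylorCertificates

/-- **The relaxed axioms minus Liouville hold at rest, quietly.** For every force `f ∈ L²` and `ν > 0`, the Dirac
mass at `u = 0` is a probability measure carried by the Leray ball, of zero mean enstrophy (so `ε = 0`), with
integrable work and the global energy inequality `ε ≤ ∫(u,f)` (both sides vanish). -/
theorem relaxed_axioms_without_liouville_at_rest {ν : ℝ} (hν : 0 < ν) (f : (UnitAddTorus (Fin 3) → EuclideanSpace ℝ (Fin 3))) :
    IsProbabilityMeasure (Measure.dirac (0 : Torus.energySpace (Fin 3))) ∧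
      (∀ᵐ u ∂(Measure.dirac (0 : Torus.energySpace (Fin 3))), ‖u‖ ^ 2 ≤ 16 * (∫ x, ‖f x‖ ^ 2) / ν ^ 2) ∧
      Torus.ensembleEnstrophy (Measure.dirac (0 : Torus.energySpace (Fin 3))) = 0 ∧
      Integrable (fun u : Torus.energySpace (Fin 3) => Torus.pairing (u : Lp (EuclideanSpace ℝ (Fin 3)) 2 (volume : Measure (UnitAddTorus (Fin 3)))) f) (Measure.dirac (0 : Torus.energySpace (Fin 3))) ∧
      Torus.ensembleDissipation ν (Measure.dirac (0 : Torus.energySpace (Fin 3))) ≤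
        ∫ u, Torus.pairing (u : Lp (EuclideanSpace ℝ (Fin 3)) 2 (volume : Measure (UnitAddTorus (Fin 3)))) f ∂(Measure.dirac (0 : Torus.energySpace (Fin 3))) ∧
      Torus.ensembleDissipation ν (Measure.dirac (0 : Torus.energySpace (Fin 3))) = 0 := by
  haveI : MeasurableSingletonClass (Torus.energySpace (Fin 3)) := OpensMeasurableSpace.toMeasurableSingletonClass
  -- the state at rest: its `L²` class is `0`, its representative is a.e. `0`, its spectral enstrophy is `0`
  have hcoe : (((0 : Torus.energySpace (Fin 3)) : Lp (EuclideanSpace ℝ (Fin 3)) 2 (volume : Measure (UnitAddTorus (Fin 3)))) : UnitAddTorus (Fin 3) → EuclideanSpace ℝ (Fin 3)) =ᵐ[volume] (0 : (UnitAddTorus (Fin 3) → EuclideanSpace ℝ (Fin 3))) := by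
    have h1 : ((0 : Torus.energySpace (Fin 3)) : Lp (EuclideanSpace ℝ (Fin 3)) 2 (volume : Measure (UnitAddTorus (Fin 3)))) = 0 := rfl
    rw [h1]
    exact Lp.coeFn_zero _ _ _
  have hG0 : Torus.eGradNormSq (((0 : Torus.energySpace (Fin 3)) : Lp (EuclideanSpace ℝ (Fin 3)) 2 (volume : Measure (UnitAddTorus (Fin 3)))) : UnitAddTorus (Fin 3) → EuclideanSpace ℝ (Fin 3)) = 0 := by
    rw [Torus.eGradNormSq_congr_ae_eq hcoe]
    exact Torus.eGradNormSq_zero_fun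
  have hZ : Torus.ensembleEnstrophy (Measure.dirac (0 : Torus.energySpace (Fin 3))) = 0 := by
    unfold Torus.ensembleEnstrophy
    rw [lintegral_dirac]
    exact hG0
  have hD : Torus.ensembleDissipation ν (Measure.dirac (0 : Torus.energySpace (Fin 3))) = 0 := by
    simp [Torus.ensembleDissipation, hZ]
  have hpair0 : Torus.pairing ((0 : Torus.energySpace (Fin 3)) : Lp (EuclideanSpace ℝ (Fin 3)) 2 (volume : Measure (UnitAddTorus (Fin 3)))) f = 0 := by
    unfold Torus.pairing
    have : (fun x => ⟪(((0 : Torus.energySpace (Fin 3)) : Lp (EuclideanSpace ℝ (Fin 3)) 2 (volume : Measure (UnitAddTorus (Fin 3)))) : UnitAddTorus (Fin 3) → EuclideanSpace ℝ (Fin 3)) x, f x⟫_ℝ) =ᵐ[volume] fun _ => (0 : ℝ) := by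
      filter_upwards [hcoe] with x hx
      rw [hx]
      simp
    rw [integral_congr_ae this, integral_zero]
  refine ⟨inferInstance, ?_, hZ, Torus.integrable_dirac _ _, ?_, hD⟩
  · rw [ae_dirac_iff]
    · have h0 : (0 : ℝ) ≤ 16 * (∫ x, ‖f x‖ ^ 2) / ν ^ 2 := by positivity
      simpa using h0
    · exact measurableSet_le (continuous_norm.pow 2).measurable measurable_const
  · rw [hD, integral_dirac, hpair0]

/-- **Clause (i) of the line's stub C is false without the Liouville identities, for every force.** Deleting the
hypothesis "`μ` annihilates every cylindrical Liouville functional" from the relaxed class, no force and no `ε₀ > 0`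
make every remaining "statistic" `ε₀`-loud at any `ν`: the Dirac mass at rest is a quiet member
(`relaxed_axioms_without_liouville_at_rest`). -/
theorem stubDualPair_clause_i_false_without_liouville :
    ¬ ∃ f : (UnitAddTorus (Fin 3) → EuclideanSpace ℝ (Fin 3)), Torus.IsSmooth f ∧ Torus.IsDivFree f ∧ Torus.HasZeroMean f ∧
      ∃ ε₀ ν₀ : ℝ, 0 < ε₀ ∧ 0 < ν₀ ∧ ∀ ν : ℝ, 0 < ν → ν < ν₀ →
        ∀ μ : Measure (Torus.energySpace (Fin 3)),
          IsProbabilityMeasure μ →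
          (∀ᵐ u ∂μ, ‖u‖ ^ 2 ≤ 16 * (∫ x, ‖f x‖ ^ 2) / ν ^ 2) →
          Torus.ensembleEnstrophy μ < ⊤ →
          Integrable (fun u : Torus.energySpace (Fin 3) => Torus.pairing (u : Lp (EuclideanSpace ℝ (Fin 3)) 2 (volume : Measure (UnitAddTorus (Fin 3)))) f) μ →
          Torus.ensembleDissipation ν μ ≤ ∫ u, Torus.pairing (u : Lp (EuclideanSpace ℝ (Fin 3)) 2 (volume : Measure (UnitAddTorus (Fin 3)))) f ∂μ →
          ε₀ ≤ Torus.ensembleDissipation ν μ := by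
  rintro ⟨f, hfs, -, -, ε₀, ν₀, hε₀, hν₀, h⟩
  obtain ⟨hprob, hball, hZ, hB, hE, hD⟩ :=
    relaxed_axioms_without_liouville_at_rest (half_pos hν₀) f
  have := h (ν₀ / 2) (half_pos hν₀) (by linarith) _ hprob hball (by rw [hZ]; exact ENNReal.zero_lt_top) hB hE
  rw [hD] at this
  linarith

end Summit.AnomalousDissipation.AnomalousDissipation.Theorems.FloorCertificateEnsembleCeiling.Negative

end
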